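import Literature.MathematicalPhysics.QuantumLattice.EuclideanAction
import HarnessLib

/-!
# Crux `NT` (stmt-QuantumFields-19353): the subsequential leaf tolerates witnesses MOVING IN A COMPACT FAMILY —
# compactness + an equicontinuity modulus select ONE witness (pure analysis; the dilation family prepared)

Helper file (`--supports stmt-QuantumFields-19353`) of the fleet lead prover of crux `NT` (unit `ym-spine-19353-p1`, g29),
hypothesis-free; sequel of `…NTSubsequentialBridge` (`Y2Bridge.yangMills_of_subseqNTLegs`: the summit needs NT's two floors only
on a cofinal set of couplings, at each on tori of unbounded size, for ONE positive-time witness `v` and ONE disjoint triple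
`f, g, h`).  This file removes «ONE»: if at every good coupling `β` the floors are carried by a member `W(μ β)` of a family
indexed by a parameter `μ β` in a compact interval `[m₁, m₂]`, and the two smeared functionals are LIPSCHITZ in the parameter
uniformly over the admissible `(β, L)` (an equicontinuity modulus — for NT's `Q2`, `|Q3|` it is supplied by the UV leg's collar
bound, next files), then ONE parameter `μ∞ ∈ [m₁, m₂]` carries both floors (halved) in the subsequential form
(`subseq_of_lipschitzFamily`: Bolzano–Weierstrass on `μ(β_k)` along a cofinal sequence + the modulus).

§2 prepares the family used downstream — DILATES `v ∘ (μ •)` of a compactly supported Schwartz witness: a global Lipschitz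
constant of a Schwartz function (`exists_lipschitz_const`), the sup bound `|v(μ y) − v(ν y)| ≤ Lip·(σ/m₁)·|μ − ν|` for
`tsupport v ⊆ B̄(0, σ)`, `μ, ν ≥ m₁ > 0` (`abs_dilate_sub_dilate_le`), and the support / time-gap bookkeeping of dilates read at
smeared lattice points (`norm_le_of_dilate_ne_zero`, `gap_of_dilate_ne_zero`).

WHY (for 19353 / 20043).  With the dilation family this yields (file `…NTSubsequentialUnitRobustness`) that NT's floors at unit
`a` transfer to ANY unit `a'` with `a'/a` bounded above and below on the good couplings, given the collar bound `MomentBounds`: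
the calibration «NT fixes the unit» is only up to bounded β-DEPENDENT factors as far as the summit bridge is concerned (the
tree's `UVSeamRec.UnitDilation.lowerBounds_const_mul_iff` is the constant-factor case, exact).  HONEST FRAMING: elementary real
analysis; nothing about `NT`, floors, the gap, or Clay. [folklore]
-/

set_option autoImplicit false

noncomputable section

open scoped SchwartzMap
open MeasureTheory Filter Topology Set
open Literature.MathematicalPhysics.QuantumLattice

namespace Summit.QuantumFields.YangMills.Cruxes.NT.Subsequential

/-! ## §1 Compact parameter families: a moving witness with a Lipschitz modulus yields a fixed witness -/

/-- **Compact families of witnesses reduce to one witness.**  Let `Bset` be a cofinal set of couplings; at each `β ∈ Bset`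
let a parameter `μf β ∈ [m₁, m₂]` carry, on tori of unbounded size, the two floors `ε ≤ Φ β L (μf β)`, `ε' ≤ Ψ β L (μf β)`;
assume both functionals are `Mod`-Lipschitz in the parameter on `[m₁, m₂]`, uniformly over `β ∈ Bset` and `L ≥ Dm β`.
Then some FIXED `μ ∈ [m₁, m₂]` carries `ε/2 ≤ Φ β L μ`, `ε'/2 ≤ Ψ β L μ` on a cofinal `Bset' ⊆ Bset`, at each of its couplings on
tori of unbounded size (Bolzano–Weierstrass along a cofinal sequence of couplings, then the modulus). [folklore] -/
theorem subseq_of_lipschitzFamily {Bset : Set ℝ} (hcof : ∀ x : ℝ, ∃ β ∈ Bset, x ≤ β) {m₁ m₂ : ℝ}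
    (Φ Ψ : ℝ → ℕ → ℝ → ℝ) (μf : ℝ → ℝ) (hμ : ∀ β ∈ Bset, μf β ∈ Icc m₁ m₂)
    {ε ε' Mod : ℝ} (hε : 0 < ε) (hε' : 0 < ε') (hMod : 0 ≤ Mod) (Dm : ℝ → ℕ)
    (hfloor : ∀ β ∈ Bset, ∀ D : ℕ, ∃ L : ℕ, D ≤ L ∧ ε ≤ Φ β L (μf β) ∧ ε' ≤ Ψ β L (μf β))
    (hΦ : ∀ β ∈ Bset, ∀ L : ℕ, Dm β ≤ L → ∀ μ ∈ Icc m₁ m₂, ∀ ν ∈ Icc m₁ m₂, |Φ β L μ - Φ β L ν| ≤ Mod * |μ - ν|)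
    (hΨ : ∀ β ∈ Bset, ∀ L : ℕ, Dm β ≤ L → ∀ μ ∈ Icc m₁ m₂, ∀ ν ∈ Icc m₁ m₂, |Ψ β L μ - Ψ β L ν| ≤ Mod * |μ - ν|) :
    ∃ μ ∈ Icc m₁ m₂, ∃ Bset' : Set ℝ, Bset' ⊆ Bset ∧ (∀ x : ℝ, ∃ β ∈ Bset', x ≤ β) ∧
      ∀ β ∈ Bset', ∀ D : ℕ, ∃ L : ℕ, D ≤ L ∧ ε / 2 ≤ Φ β L μ ∧ ε' / 2 ≤ Ψ β L μ := by
  -- a cofinal sequence of good couplings and its parameters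
  have hchoice : ∀ k : ℕ, ∃ β ∈ Bset, (k : ℝ) ≤ β := fun k => hcof k
  choose βs hβsmem hβsge using hchoice
  have hμs : ∀ k, μf (βs k) ∈ Icc m₁ m₂ := fun k => hμ _ (hβsmem k)
  -- Bolzano–Weierstrass
  obtain ⟨μ, hμmem, φ, hφ, hlim⟩ := isCompact_Icc.tendsto_subseq hμs
  refine ⟨μ, hμmem, ?_⟩
  -- the modulus scale
  set η : ℝ := min ε ε' / (2 * (Mod + 1)) with hη
  have hη0 : 0 < η := by rw [hη]; exact div_pos (lt_min hε hε') (by positivity)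
  have hModη : Mod * η ≤ min ε ε' / 2 := by
    rw [hη]
    have h1 : Mod * (min ε ε' / (2 * (Mod + 1))) = (Mod / (Mod + 1)) * (min ε ε' / 2) := by
      field_simp
    rw [h1]
    have h2 : Mod / (Mod + 1) ≤ 1 := by rw [div_le_one (by positivity)]; linarith
    exact (mul_le_mul_of_nonneg_right h2 (by positivity)).trans (by rw [one_mul])
  obtain ⟨N, hN⟩ := (Metric.tendsto_atTop.1 hlim) η hη0
  -- the cofinal subset
  refine ⟨{β | ∃ j : ℕ, N ≤ j ∧ β = βs (φ j)}, ?_, fun x => ?_, ?_⟩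
  · rintro β ⟨j, -, rfl⟩; exact hβsmem _
  · refine ⟨βs (φ (max N ⌈x⌉₊)), ⟨max N ⌈x⌉₊, le_max_left _ _, rfl⟩, ?_⟩
    have h1 : (⌈x⌉₊ : ℝ) ≤ ((φ (max N ⌈x⌉₊) : ℕ) : ℝ) := by
      exact_mod_cast (le_max_right N ⌈x⌉₊).trans (hφ.id_le _)
    exact (Nat.le_ceil x).trans (h1.trans (hβsge _))
  · rintro β ⟨j, hj, rfl⟩ D
    obtain ⟨L, hL, hΦL, hΨL⟩ := hfloor _ (hβsmem (φ j)) (max D (Dm (βs (φ j))))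
    have hclose : |μf (βs (φ j)) - μ| ≤ η := by
      have h := hN j hj
      rw [Function.comp_apply, dist_eq_norm, Real.norm_eq_abs] at h
      exact h.le
    have hΦd := hΦ _ (hβsmem (φ j)) L (le_of_max_le_right hL) μ hμmem (μf (βs (φ j))) (hμs (φ j))
    have hΨd := hΨ _ (hβsmem (φ j)) L (le_of_max_le_right hL) μ hμmem (μf (βs (φ j))) (hμs (φ j))
    rw [abs_sub_comm] at hclose
    have hb : Mod * |μ - μf (βs (φ j))| ≤ min ε ε' / 2 :=
      (mul_le_mul_of_nonneg_left hclose hMod).trans hModη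
    refine ⟨L, le_of_max_le_left hL, ?_, ?_⟩
    · have h1 := (abs_sub_le_iff.1 (hΦd.trans hb)).2
      linarith [min_le_left ε ε']
    · have h1 := (abs_sub_le_iff.1 (hΨd.trans hb)).2
      linarith [min_le_right ε ε']

/-! ## §2 The dilation family of a compactly supported Schwartz witness -/

section Dilates

/-- **A Schwartz function is globally Lipschitz**: `|v x − v y| ≤ Lip·‖x − y‖` with `Lip = 𝓢-seminorm (0, 1)` (mean value
theorem with the uniform bound on the derivative). [folklore] -/
theorem exists_lipschitz_const (v : 𝓢(EuclideanSpace ℝ (Fin 4), ℝ)) :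
    ∃ Lip : ℝ, 0 ≤ Lip ∧ ∀ x y : EuclideanSpace ℝ (Fin 4), |v x - v y| ≤ Lip * ‖x - y‖ := by
  refine ⟨SchwartzMap.seminorm ℝ 0 1 v, apply_nonneg _ _, fun x y => ?_⟩
  have hdec : ∀ z : EuclideanSpace ℝ (Fin 4), ‖fderiv ℝ (⇑v) z‖ ≤ SchwartzMap.seminorm ℝ 0 1 v := by
    intro z
    have h := SchwartzMap.le_seminorm ℝ 0 1 v z
    rw [pow_zero, one_mul, norm_iteratedFDeriv_one] at h
    exact h
  have hmv := Convex.norm_image_sub_le_of_norm_fderiv_le (fun z _ => v.differentiableAt) (fun z _ => hdec z)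
    convex_univ (mem_univ y) (mem_univ x)
  rw [Real.norm_eq_abs] at hmv
  exact hmv

/-- **Sup bound on the difference of two dilates of a compactly supported Schwartz function**: if `tsupport v ⊆ B̄(0, σ)`,
`0 < m₁ ≤ μ, ν`, then `|v(μ y) − v(ν y)| ≤ Lip·(σ/m₁)·|μ − ν|` for every `y` (a charged `y` has `‖y‖ ≤ σ/m₁`). [folklore] -/
theorem abs_dilate_sub_dilate_le {v : 𝓢(EuclideanSpace ℝ (Fin 4), ℝ)} {Lip : ℝ} (hLip0 : 0 ≤ Lip)
    (hLip : ∀ x y : EuclideanSpace ℝ (Fin 4), |v x - v y| ≤ Lip * ‖x - y‖) {σ : ℝ} (hσ : 0 ≤ σ)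
    (hvσ : tsupport (v : EuclideanSpace ℝ (Fin 4) → ℝ) ⊆ Metric.closedBall 0 σ) {m₁ μ ν : ℝ} (hm₁ : 0 < m₁)
    (hμ : m₁ ≤ μ) (hν : m₁ ≤ ν) (y : EuclideanSpace ℝ (Fin 4)) :
    |v (μ • y) - v (ν • y)| ≤ Lip * (σ / m₁) * |μ - ν| := by
  -- a charged point lies in the ball of radius `σ/m₁`
  have hball : ∀ {ρ : ℝ}, m₁ ≤ ρ → v (ρ • y) ≠ 0 → ‖y‖ ≤ σ / m₁ := by
    intro ρ hρ hne
    have hmem := hvσ (subset_tsupport _ (Function.mem_support.2 hne))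
    rw [Metric.mem_closedBall, dist_zero_right, norm_smul, Real.norm_of_nonneg (hm₁.le.trans hρ)] at hmem
    rw [le_div_iff₀ hm₁]
    calc ‖y‖ * m₁ ≤ ‖y‖ * ρ := mul_le_mul_of_nonneg_left hρ (norm_nonneg _)
      _ = ρ * ‖y‖ := mul_comm _ _
      _ ≤ σ := hmem
  by_cases hy : ‖y‖ ≤ σ / m₁
  · calc |v (μ • y) - v (ν • y)| ≤ Lip * ‖μ • y - ν • y‖ := hLip _ _
      _ = Lip * (|μ - ν| * ‖y‖) := by rw [← sub_smul, norm_smul, Real.norm_eq_abs]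
      _ ≤ Lip * (|μ - ν| * (σ / m₁)) := by gcongr
      _ = Lip * (σ / m₁) * |μ - ν| := by ring
  · -- uncharged at both parameters
    have h1 : v (μ • y) = 0 := by by_contra h; exact hy (hball hμ h)
    have h2 : v (ν • y) = 0 := by by_contra h; exact hy (hball hν h)
    rw [h1, h2, sub_zero, abs_zero]
    positivity

/-- **Support bookkeeping of a dilate read at a smeared lattice point**: if `v ((μ * s) • X) ≠ 0`, `tsupport v ⊆ B̄(0, σ)` and
`0 < m₁ ≤ μ`, then `‖s • X‖ ≤ σ / m₁`. [folklore] -/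
theorem norm_le_of_dilate_ne_zero {v : EuclideanSpace ℝ (Fin 4) → ℝ} {σ m₁ μ s : ℝ}
    (hvσ : tsupport v ⊆ Metric.closedBall 0 σ) (hm₁ : 0 < m₁) (hμ : m₁ ≤ μ)
    {X : EuclideanSpace ℝ (Fin 4)} (hne : v ((μ * s) • X) ≠ 0) : ‖s • X‖ ≤ σ / m₁ := by
  have hmem := hvσ (subset_tsupport _ (Function.mem_support.2 hne))
  rw [Metric.mem_closedBall, dist_zero_right, mul_smul, norm_smul, Real.norm_of_nonneg (hm₁.le.trans hμ)] at hmem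
  rw [le_div_iff₀ hm₁]
  calc ‖s • X‖ * m₁ ≤ ‖s • X‖ * μ := mul_le_mul_of_nonneg_left hμ (norm_nonneg _)
    _ = μ * ‖s • X‖ := mul_comm _ _
    _ ≤ σ := hmem

/-- **Time-gap bookkeeping of a dilate**: if `v ((μ * s) • X) ≠ 0`, every charged point of `v` has time coordinate `≥ δ₀ ≥ 0`,
and `0 < μ ≤ m₂`, then `δ₀ / m₂ ≤ (s • X) 0`. [folklore] -/
theorem gap_of_dilate_ne_zero {v : EuclideanSpace ℝ (Fin 4) → ℝ} {δ₀ m₂ μ s : ℝ}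
    (hv : ∀ p : EuclideanSpace ℝ (Fin 4), v p ≠ 0 → δ₀ ≤ p 0) (hδ₀ : 0 ≤ δ₀) (hμ0 : 0 < μ) (hμ : μ ≤ m₂)
    {X : EuclideanSpace ℝ (Fin 4)} (hne : v ((μ * s) • X) ≠ 0) : δ₀ / m₂ ≤ (s • X) 0 := by
  have h := hv _ hne
  rw [mul_smul, PiLp.smul_apply, smul_eq_mul] at h
  have hm₂ : 0 < m₂ := hμ0.trans_le hμ
  -- `δ₀ ≤ μ · t` with `μ ≤ m₂` gives `δ₀/m₂ ≤ t` (for `t ≥ 0`, which follows since `δ₀ ≥ 0`, `μ > 0`)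
  have ht : 0 ≤ (s • X) 0 := by
    by_contra hlt
    push Not at hlt
    have : μ * (s • X) 0 < 0 := mul_neg_of_pos_of_neg hμ0 hlt
    linarith
  rw [div_le_iff₀ hm₂]
  calc δ₀ ≤ μ * (s • X) 0 := h
    _ ≤ m₂ * (s • X) 0 := mul_le_mul_of_nonneg_right hμ ht
    _ = (s • X) 0 * m₂ := mul_comm _ _

/-- **Upper time-gap bookkeeping of a reflected dilate**: if `v (θ ((μ * s) • X)) ≠ 0` (`θ` the time reflection), every charged
point of `v` has time coordinate `≥ δ₀ ≥ 0`, and `0 < μ ≤ m₂`, then `(s • X) 0 ≤ −(δ₀ / m₂)`. [folklore] -/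
theorem neg_gap_of_theta_dilate_ne_zero {v : EuclideanSpace ℝ (Fin 4) → ℝ} {δ₀ m₂ μ s : ℝ}
    (hv : ∀ p : EuclideanSpace ℝ (Fin 4), v p ≠ 0 → δ₀ ≤ p 0) (hδ₀ : 0 ≤ δ₀) (hμ0 : 0 < μ) (hμ : μ ≤ m₂)
    {X : EuclideanSpace ℝ (Fin 4)} (hne : v (timeReflection 4 ((μ * s) • X)) ≠ 0) : (s • X) 0 ≤ -(δ₀ / m₂) := by
  have h0 := hv _ hne
  have e : (timeReflection 4 ((μ * s) • X)) 0 = μ * -((s • X) 0) := by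
    simp [PiLp.smul_apply, smul_eq_mul]; ring
  have h : δ₀ ≤ μ * -((s • X) 0) := by rw [← e]; exact h0
  have hm₂ : 0 < m₂ := hμ0.trans_le hμ
  have ht : 0 ≤ -((s • X) 0) := by
    by_contra hlt
    push Not at hlt
    have : μ * -((s • X) 0) < 0 := mul_neg_of_pos_of_neg hμ0 hlt
    linarith
  rw [le_neg, div_le_iff₀ hm₂]
  calc δ₀ ≤ μ * -((s • X) 0) := h
    _ ≤ m₂ * -((s • X) 0) := mul_le_mul_of_nonneg_right hμ ht
    _ = -(s • X) 0 * m₂ := by ring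

end Dilates

/-! ## §3 (appended) Local modulus: the Lipschitz bound is only needed for nearby parameters -/

/-- **Compact families of witnesses reduce to one witness — LOCAL modulus.**  As `subseq_of_lipschitzFamily`, but the two
functionals need only be `Mod`-Lipschitz in the parameter for `|μ − ν| ≤ η₀` (`η₀ > 0`): Bolzano–Weierstrass brings the
moving parameter within `min η₀ η` of its limit.  (Needed downstream: the three-point modulus of the dilation family holds
only for parameters close enough that the dilated supports stay separated.) [folklore] -/
theorem subseq_of_locLipschitzFamily {Bset : Set ℝ} (hcof : ∀ x : ℝ, ∃ β ∈ Bset, x ≤ β) {m₁ m₂ : ℝ}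
    (Φ Ψ : ℝ → ℕ → ℝ → ℝ) (μf : ℝ → ℝ) (hμ : ∀ β ∈ Bset, μf β ∈ Icc m₁ m₂)
    {ε ε' Mod η₀ : ℝ} (hε : 0 < ε) (hε' : 0 < ε') (hMod : 0 ≤ Mod) (hη₀ : 0 < η₀) (Dm : ℝ → ℕ)
    (hfloor : ∀ β ∈ Bset, ∀ D : ℕ, ∃ L : ℕ, D ≤ L ∧ ε ≤ Φ β L (μf β) ∧ ε' ≤ Ψ β L (μf β))
    (hΦ : ∀ β ∈ Bset, ∀ L : ℕ, Dm β ≤ L → ∀ μ ∈ Icc m₁ m₂, ∀ ν ∈ Icc m₁ m₂, |μ - ν| ≤ η₀ →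
      |Φ β L μ - Φ β L ν| ≤ Mod * |μ - ν|)
    (hΨ : ∀ β ∈ Bset, ∀ L : ℕ, Dm β ≤ L → ∀ μ ∈ Icc m₁ m₂, ∀ ν ∈ Icc m₁ m₂, |μ - ν| ≤ η₀ →
      |Ψ β L μ - Ψ β L ν| ≤ Mod * |μ - ν|) :
    ∃ μ ∈ Icc m₁ m₂, ∃ Bset' : Set ℝ, Bset' ⊆ Bset ∧ (∀ x : ℝ, ∃ β ∈ Bset', x ≤ β) ∧
      ∀ β ∈ Bset', ∀ D : ℕ, ∃ L : ℕ, D ≤ L ∧ ε / 2 ≤ Φ β L μ ∧ ε' / 2 ≤ Ψ β L μ := by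
  -- a cofinal sequence of good couplings and its parameters
  have hchoice : ∀ k : ℕ, ∃ β ∈ Bset, (k : ℝ) ≤ β := fun k => hcof k
  choose βs hβsmem hβsge using hchoice
  have hμs : ∀ k, μf (βs k) ∈ Icc m₁ m₂ := fun k => hμ _ (hβsmem k)
  -- Bolzano–Weierstrass
  obtain ⟨μ, hμmem, φ, hφ, hlim⟩ := isCompact_Icc.tendsto_subseq hμs
  refine ⟨μ, hμmem, ?_⟩
  -- the modulus scale, capped by `η₀`
  set η : ℝ := min η₀ (min ε ε' / (2 * (Mod + 1))) with hη
  have hη0 : 0 < η := by rw [hη]; exact lt_min hη₀ (div_pos (lt_min hε hε') (by positivity))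
  have hηη₀ : η ≤ η₀ := min_le_left _ _
  have hModη : Mod * η ≤ min ε ε' / 2 := by
    have h0 : Mod * η ≤ Mod * (min ε ε' / (2 * (Mod + 1))) := mul_le_mul_of_nonneg_left (min_le_right _ _) hMod
    refine h0.trans ?_
    have h1 : Mod * (min ε ε' / (2 * (Mod + 1))) = (Mod / (Mod + 1)) * (min ε ε' / 2) := by
      field_simp
    rw [h1]
    have h2 : Mod / (Mod + 1) ≤ 1 := by rw [div_le_one (by positivity)]; linarith
    exact (mul_le_mul_of_nonneg_right h2 (by positivity)).trans (by rw [one_mul])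
  obtain ⟨N, hN⟩ := (Metric.tendsto_atTop.1 hlim) η hη0
  -- the cofinal subset
  refine ⟨{β | ∃ j : ℕ, N ≤ j ∧ β = βs (φ j)}, ?_, fun x => ?_, ?_⟩
  · rintro β ⟨j, -, rfl⟩; exact hβsmem _
  · refine ⟨βs (φ (max N ⌈x⌉₊)), ⟨max N ⌈x⌉₊, le_max_left _ _, rfl⟩, ?_⟩
    have h1 : (⌈x⌉₊ : ℝ) ≤ ((φ (max N ⌈x⌉₊) : ℕ) : ℝ) := by
      exact_mod_cast (le_max_right N ⌈x⌉₊).trans (hφ.id_le _)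
    exact (Nat.le_ceil x).trans (h1.trans (hβsge _))
  · rintro β ⟨j, hj, rfl⟩ D
    obtain ⟨L, hL, hΦL, hΨL⟩ := hfloor _ (hβsmem (φ j)) (max D (Dm (βs (φ j))))
    have hclose : |μ - μf (βs (φ j))| ≤ η := by
      have h := hN j hj
      rw [Function.comp_apply, dist_eq_norm, Real.norm_eq_abs, abs_sub_comm] at h
      exact h.le
    have hΦd := hΦ _ (hβsmem (φ j)) L (le_of_max_le_right hL) μ hμmem (μf (βs (φ j))) (hμs (φ j))
      (hclose.trans hηη₀)
    have hΨd := hΨ _ (hβsmem (φ j)) L (le_of_max_le_right hL) μ hμmem (μf (βs (φ j))) (hμs (φ j))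
      (hclose.trans hηη₀)
    have hb : Mod * |μ - μf (βs (φ j))| ≤ min ε ε' / 2 :=
      (mul_le_mul_of_nonneg_left hclose hMod).trans hModη
    refine ⟨L, le_of_max_le_left hL, ?_, ?_⟩
    · have h1 := (abs_sub_le_iff.1 (hΦd.trans hb)).2
      linarith [min_le_left ε ε']
    · have h1 := (abs_sub_le_iff.1 (hΨd.trans hb)).2
      linarith [min_le_right ε ε']

end Summit.QuantumFields.YangMills.Cruxes.NT.Subsequential

end
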